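import Mathlib

/-!
# The iterated-resultant walk, I: level polynomials and their specialisations

First half (definitions `stepPoly`, `levelPoly`, the product formula at a specialisation
`spec_levelPoly_succ_eq_prod`, and the degree/roots induction `natDegree_spec_levelPoly`,
`mul_mem_roots_spec_levelPoly`) of the core algebraic lemma behind the hard case of the sweep
(`stub_sweepLine_hardCore` of crux stmt-Schanuel-0969, line kernel-arithmetic-selection); the
conclusion is drawn in `…SweepLineHardCoreWalkLine`. Setting, over an algebraically closed field
`F` of characteristic `0`:

* `W ⊆ Fⁿ` the common zero set of a finite set `G` of polynomials, `δ' = max deg G`;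
* `O ⊆ W` a set of "generic points" and `M ∈ F[X₁…Xₙ][T]` a polynomial whose `T`-leading
  coefficient does not vanish on `O`, with the **walk property** along a parameter set
  `Λ₀ ⊆ Fⁿ` and base parameter `q₀ ∈ Λ₀`: for `z ∈ O`, every root `θ` of `M(z; T)` and every
  `m ∈ Λ₀`, the point `z + θ (m - q₀)` is again in `O`;
* a base point `x ∈ O` and `c ≠ 0` with `M(x; c) = 0`;
* `Λ₀` Zariski dense in an irreducible closed set: `I_F(Λ₀) = 𝔭` prime, and `Λ₀ ∌` only `q₀`.

Conclusion (`Walk.exists_line_subset`, part II): for some `m ∈ Λ₀`, `m ≠ q₀`, the whole line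
`x + F·(m - q₀)` lies in `W`.

Proof. For a direction `v = m - q₀` consider the positions `s ∈ F` with `x + s v ∈ O`; by the walk
property they contain `θ₁ + θ₂ + ⋯ + θⱼ` for every chain of roots `θ₁` of `M(x; ·)`, `θ₂` of
`M(x + θ₁v; ·)`, … . These level-`j` positions are the roots of a polynomial `N_j(T; q)` defined
uniformly in the parameter `q` by iterated resultants (`levelPoly`; product formula for the
resultant at every specialisation, `spec_levelPoly_succ_eq_prod`), of exact degree `dʲ`. At `q = q₀`
(`v = 0`) the number `j c` is a root of `N_j` (the chain `c, c, …, c`), so `∏_{j ≤ J} N_j(·; q₀)`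
has
at least `J` distinct roots; by lower semicontinuity of the number of distinct roots under
specialisation over the coordinate ring of `Z(𝔭)`
(`Literature.RingTheory.Elimination.card_roots_toFinset_le`) and the density of `Λ₀`, the same
holds at some `m ∈ Λ₀`, `m ≠ q₀`. But if the line `x + F v` is not contained in `W`, it meets `W` in
at most `δ'` points, which bounds the number of positions by `δ' < J := δ' + 1`.

## References

* [Lang2002] S. Lang, *Algebra*, 3rd ed., GTM 211, Ch. IV §8 (the resultant; `Res(f, g) =
  lc(f)^{deg g} ∏_{f(α)=0} g(α)` and its compatibility with ring homomorphisms).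
-/

noncomputable section

open Polynomial

namespace Literature.RingTheory.Elimination.Walk

variable {F : Type*} [Field F] {n : ℕ}

/-! ### The step polynomial and the level polynomials -/

/-- The ring homomorphism `F[X₁…Xₙ] → F[q][T][θ]` substituting `Xᵢ ↦ xᵢ + θ (qᵢ - q₀ᵢ)`. [folklore]
-/
def stepHom (x q₀ : Fin n → F) :
    MvPolynomial (Fin n) F →+* Polynomial (Polynomial (MvPolynomial (Fin n) F)) :=
  MvPolynomial.eval₂Hom (Polynomial.C.comp (Polynomial.C.comp MvPolynomial.C))
    fun i => Polynomial.C (Polynomial.C (MvPolynomial.C (x i))) +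
      Polynomial.X * Polynomial.C (Polynomial.C (MvPolynomial.X i - MvPolynomial.C (q₀ i)))

/-- The **step polynomial** `M(x + θ (q - q₀); T - θ)`, a polynomial in `θ` over `F[q][T]`.
[folklore] -/
def stepPoly (M : Polynomial (MvPolynomial (Fin n) F)) (x q₀ : Fin n → F) :
    Polynomial (Polynomial (MvPolynomial (Fin n) F)) :=
  M.eval₂ (stepHom x q₀) (Polynomial.C Polynomial.X - Polynomial.X)

/-- The **level polynomials** `N_j(T; q) ∈ F[q][T]`: `N₀ = M(x; T)` and
`N_{j+1} = Res_θ (N_j(θ), M(x + θ(q - q₀); T - θ))`, the resultant taken with the formal degrees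
`d^{j+1}` (`d = deg_T M`) and `deg_θ` of the step polynomial. [folklore] -/
def levelPoly (M : Polynomial (MvPolynomial (Fin n) F)) (x q₀ : Fin n → F) :
    ℕ → Polynomial (MvPolynomial (Fin n) F)
  | 0 => (M.map (MvPolynomial.eval x)).map (MvPolynomial.C : F →+* MvPolynomial (Fin n) F)
  | j + 1 => Polynomial.resultant ((levelPoly M x q₀ j).map Polynomial.C) (stepPoly M x q₀)
      (M.natDegree ^ (j + 1)) (stepPoly M x q₀).natDegree

/-- Specialisation of the parameter `q ↦ m`: `F[q][T] → F[T]`. [folklore] -/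
abbrev spec (m : Fin n → F) : Polynomial (MvPolynomial (Fin n) F) →+* Polynomial F :=
  Polynomial.mapRingHom (MvPolynomial.eval m)

/-! ### Specialising the construction -/

/-- Specialising `N₀` gives back `M(x; T)`. [folklore] -/
theorem spec_levelPoly_zero (M : Polynomial (MvPolynomial (Fin n) F)) (x q₀ m : Fin n → F) :
    spec m (levelPoly M x q₀ 0) = M.map (MvPolynomial.eval x) := by
  simp only [levelPoly, spec, Polynomial.coe_mapRingHom, Polynomial.map_map]
  have : (MvPolynomial.eval m).comp (MvPolynomial.C : F →+* MvPolynomial (Fin n) F) =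
      RingHom.id F := by
    ext a; simp
  rw [← RingHom.comp_assoc, this, RingHom.id_comp]

/-- The specialised step polynomial evaluated at `θ = α`: `M(x + α (m - q₀); T - α)`. [folklore] -/
theorem eval_C_map_stepPoly (M : Polynomial (MvPolynomial (Fin n) F)) (x q₀ m : Fin n → F)
    (α : F) :
    ((stepPoly M x q₀).map (spec m)).eval (C α) =
      (M.map (MvPolynomial.eval (x + α • (m - q₀)))).comp (X - C α) := by
  -- both sides are images of `M` under ring homomorphisms `F[X][T] → F[T]`
  simp only [stepPoly]
  rw [← Polynomial.coe_evalRingHom, ← Polynomial.coe_mapRingHom, Polynomial.hom_eval₂,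
    Polynomial.hom_eval₂]
  rw [Polynomial.comp, Polynomial.eval₂_map]
  congr 1
  · -- the coefficient homomorphisms agree
    refine MvPolynomial.ringHom_ext (fun a => ?_) (fun i => ?_)
    · simp [stepHom]
    · simp only [stepHom, RingHom.coe_comp, Function.comp_apply, MvPolynomial.eval₂Hom_X',
        Polynomial.coe_mapRingHom, Polynomial.coe_evalRingHom, Polynomial.map_add,
        Polynomial.map_mul, Polynomial.map_C, Polynomial.map_X, MvPolynomial.eval_C,
        MvPolynomial.eval_X, eval_add, eval_C, eval_mul, eval_X,
        Pi.add_apply, Pi.smul_apply, Pi.sub_apply, smul_eq_mul]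
      rw [← Polynomial.C_mul, ← Polynomial.C_add]
      simp [MvPolynomial.eval_sub]
  · simp

/-- Specialising the level polynomials: `N_{j+1}(m)` is the resultant of `N_j(m)(θ)` and the
specialised step polynomial. [folklore] -/
theorem spec_levelPoly_succ (M : Polynomial (MvPolynomial (Fin n) F)) (x q₀ m : Fin n → F)
    (j : ℕ) :
    spec m (levelPoly M x q₀ (j + 1)) =
      Polynomial.resultant ((spec m (levelPoly M x q₀ j)).map C) ((stepPoly M x q₀).map (spec m))
        (M.natDegree ^ (j + 1)) (stepPoly M x q₀).natDegree := by
  show Polynomial.map (MvPolynomial.eval m) (Polynomial.resultant _ _ _ _) = _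
  rw [← Polynomial.coe_mapRingHom (MvPolynomial.eval m), ← Polynomial.resultant_map_map,
    Polynomial.map_map, Polynomial.coe_mapRingHom, Polynomial.map_map]
  congr 2
  refine RingHom.ext fun a => ?_
  simp


/-! ### The product formula at a specialisation -/

section Product

variable [IsAlgClosed F]

/-- **Product formula for the specialised level polynomials.** If `N_j(m)` has the expected degree
`d^{j+1}`, then
`N_{j+1}(m)(T) = lc(N_j(m))^{deg_θ step} · ∏_{β root of N_j(m)} M(x + β(m - q₀); T - β)`.
[folklore] -/
theorem spec_levelPoly_succ_eq_prod (M : Polynomial (MvPolynomial (Fin n) F)) (x q₀ m : Fin n → F)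
    (j : ℕ) (hdeg : (spec m (levelPoly M x q₀ j)).natDegree = M.natDegree ^ (j + 1)) :
    spec m (levelPoly M x q₀ (j + 1)) =
      C ((spec m (levelPoly M x q₀ j)).leadingCoeff ^ (stepPoly M x q₀).natDegree) *
        ((spec m (levelPoly M x q₀ j)).roots.map fun β =>
          (M.map (MvPolynomial.eval (x + β • (m - q₀)))).comp (X - C β)).prod := by
  set f : Polynomial (Polynomial F) := (spec m (levelPoly M x q₀ j)).map (C : F →+* F[X]) with hf
  set g : Polynomial (Polynomial F) := (stepPoly M x q₀).map (spec m) with hg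
  have hfdeg : f.natDegree = M.natDegree ^ (j + 1) := by
    rw [hf, natDegree_map_eq_of_injective C_injective, hdeg]
  have hfsplit : f.Splits := (IsAlgClosed.splits _).map C
  have hgdeg : g.natDegree ≤ (stepPoly M x q₀).natDegree := natDegree_map_le
  have hres := resultant_eq_prod_eval f g _ hgdeg hfsplit
  have hflc : f.leadingCoeff = C (spec m (levelPoly M x q₀ j)).leadingCoeff := by
    rw [hf, leadingCoeff_map_of_injective C_injective]
  have hfroots : f.roots = (spec m (levelPoly M x q₀ j)).roots.map (C : F →+* F[X]) := by
    rw [hf]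
    exact (IsAlgClosed.splits _).roots_map C
  rw [spec_levelPoly_succ, ← hf, ← hg, ← hfdeg, hres, hflc, ← C_pow, hfroots, Multiset.map_map]
  congr 2
  refine Multiset.map_congr rfl fun β _ => ?_
  simp only [Function.comp_apply, hg]
  exact eval_C_map_stepPoly M x q₀ m β

end Product

/-! ### The walk: roots of the level polynomials are positions of points of `O` -/

section Induction

variable [IsAlgClosed F] {M : Polynomial (MvPolynomial (Fin n) F)} {x q₀ : Fin n → F}
  {O : Set (Fin n → F)}

/-- **Degrees and roots of the specialised level polynomials.** If the `T`-leading coefficient of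
`M` does not vanish on `O`, `x ∈ O`, and the direction `m` has the walk property, then `N_j(m)` is
nonzero of degree `d^{j+1}` and each of its roots `β` is the position of a point `x + β(m - q₀)` of
`O` on the line through `x` in direction `m - q₀`. [folklore] -/
theorem natDegree_spec_levelPoly (hd : 1 ≤ M.natDegree)
    (hO : ∀ z ∈ O, MvPolynomial.eval z M.leadingCoeff ≠ 0) (hx : x ∈ O) {m : Fin n → F}
    (hwalk : ∀ z ∈ O, ∀ θ : F, (M.map (MvPolynomial.eval z)).IsRoot θ → z + θ • (m - q₀) ∈ O)
    (j : ℕ) :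
    (spec m (levelPoly M x q₀ j)).natDegree = M.natDegree ^ (j + 1) ∧
      spec m (levelPoly M x q₀ j) ≠ 0 ∧
      ∀ β ∈ (spec m (levelPoly M x q₀ j)).roots, x + β • (m - q₀) ∈ O := by
  induction j with
  | zero =>
    rw [spec_levelPoly_zero]
    have hlc : (MvPolynomial.eval x) M.leadingCoeff ≠ 0 := hO x hx
    have h1 : (M.map (MvPolynomial.eval x)).natDegree = M.natDegree :=
      natDegree_map_of_leadingCoeff_ne_zero _ hlc
    refine ⟨by rw [pow_one, h1], fun h0 => ?_, fun β hβ => ?_⟩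
    · rw [h0, natDegree_zero] at h1
      omega
    · have h := (mem_roots'.1 hβ).2
      exact hwalk x hx β h
  | succ j ih =>
    obtain ⟨hdeg, hne, hroots⟩ := ih
    have key := spec_levelPoly_succ_eq_prod M x q₀ m j hdeg
    -- each factor has degree `d` and is nonzero
    have hfac : ∀ β ∈ (spec m (levelPoly M x q₀ j)).roots,
        ((M.map (MvPolynomial.eval (x + β • (m - q₀)))).comp (X - C β)).natDegree = M.natDegree ∧
        (M.map (MvPolynomial.eval (x + β • (m - q₀)))).comp (X - C β) ≠ 0 := by
      intro β hβ
      have hlc := hO _ (hroots β hβ)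
      have h1 : (M.map (MvPolynomial.eval (x + β • (m - q₀)))).natDegree = M.natDegree :=
        natDegree_map_of_leadingCoeff_ne_zero _ hlc
      have h2 : ((M.map (MvPolynomial.eval (x + β • (m - q₀)))).comp (X - C β)).natDegree =
          M.natDegree := by
        rw [natDegree_comp, h1, natDegree_X_sub_C, mul_one]
      refine ⟨h2, fun h0 => ?_⟩
      rw [h0, natDegree_zero] at h2
      omega
    set t : Multiset (Polynomial F) := (spec m (levelPoly M x q₀ j)).roots.map fun β =>
      (M.map (MvPolynomial.eval (x + β • (m - q₀)))).comp (X - C β) with ht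
    have ht0 : (0 : Polynomial F) ∉ t := by
      rw [ht, Multiset.mem_map]
      rintro ⟨β, hβ, h0⟩
      exact (hfac β hβ).2 h0
    have hc0 : (spec m (levelPoly M x q₀ j)).leadingCoeff ^ (stepPoly M x q₀).natDegree ≠ 0 :=
      pow_ne_zero _ (leadingCoeff_ne_zero.2 hne)
    have hcard : Multiset.card (spec m (levelPoly M x q₀ j)).roots = M.natDegree ^ (j + 1) := by
      rw [← hdeg]
      exact ((IsAlgClosed.splits _).natDegree_eq_card_roots).symm
    refine ⟨?_, ?_, ?_⟩
    · -- degree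
      rw [key, natDegree_C_mul hc0, natDegree_multiset_prod t ht0, ht, Multiset.map_map]
      have : ((spec m (levelPoly M x q₀ j)).roots.map
          (natDegree ∘ fun β => (M.map (MvPolynomial.eval (x + β • (m - q₀)))).comp (X - C β))) =
          (spec m (levelPoly M x q₀ j)).roots.map fun _ => M.natDegree :=
        Multiset.map_congr rfl fun β hβ => (hfac β hβ).1
      rw [this, Multiset.map_const', Multiset.sum_replicate, hcard, smul_eq_mul, ← pow_succ]
    · -- nonzero
      rw [key]
      exact mul_ne_zero (C_ne_zero.2 hc0) (Multiset.prod_ne_zero ht0)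
    · -- roots
      intro β' hβ'
      have h := (mem_roots'.1 hβ').2
      rw [IsRoot.def, key, eval_mul, eval_C, mul_eq_zero, eval_multiset_prod,
        Multiset.prod_eq_zero_iff, Multiset.map_map, Multiset.mem_map] at h
      rcases h with h | ⟨β, hβ, h0⟩
      · exact absurd h hc0
      · simp only [Function.comp_apply, eval_comp, eval_sub, eval_X, eval_C] at h0
        have hz := hroots β hβ
        have := hwalk _ hz (β' - β) h0
        have e : x + β • (m - q₀) + (β' - β) • (m - q₀) = x + β' • (m - q₀) := by
          rw [add_assoc, ← add_smul, add_sub_cancel]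
        rwa [e] at this

/-- **At the base parameter `q = q₀` the chain `c, c, …, c` gives the root `(j+1)·c` of `N_j`.**
[folklore] -/
theorem mul_mem_roots_spec_levelPoly (hd : 1 ≤ M.natDegree)
    (hO : ∀ z ∈ O, MvPolynomial.eval z M.leadingCoeff ≠ 0) (hx : x ∈ O) {c : F}
    (hc : (M.map (MvPolynomial.eval x)).IsRoot c) (j : ℕ) :
    ((j + 1 : ℕ) : F) * c ∈ (spec q₀ (levelPoly M x q₀ j)).roots := by
  have hwalk : ∀ z ∈ O, ∀ θ : F, (M.map (MvPolynomial.eval z)).IsRoot θ →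
      z + θ • (q₀ - q₀) ∈ O := by
    intro z hz θ _
    simpa using hz
  induction j with
  | zero =>
    obtain ⟨-, hne, -⟩ := natDegree_spec_levelPoly hd hO hx hwalk 0
    rw [mem_roots', spec_levelPoly_zero]
    rw [spec_levelPoly_zero] at hne
    refine ⟨hne, ?_⟩
    simpa using hc
  | succ j ih =>
    obtain ⟨hdeg, -, -⟩ := natDegree_spec_levelPoly hd hO hx hwalk j
    obtain ⟨-, hne, -⟩ := natDegree_spec_levelPoly hd hO hx hwalk (j + 1)
    rw [mem_roots']
    refine ⟨hne, ?_⟩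
    rw [IsRoot.def, spec_levelPoly_succ_eq_prod M x q₀ q₀ j hdeg, eval_mul, eval_multiset_prod,
      Multiset.map_map]
    refine mul_eq_zero_of_right _ (Multiset.prod_eq_zero ?_)
    rw [Multiset.mem_map]
    refine ⟨_, ih, ?_⟩
    simp only [Function.comp_apply, eval_comp, eval_sub, eval_X, eval_C, sub_self, smul_zero,
      add_zero]
    have e : ((j + 1 + 1 : ℕ) : F) * c - ((j + 1 : ℕ) : F) * c = c := by
      push_cast
      ring
    rw [e]
    exact hc

end Induction

end Literature.RingTheory.Elimination.Walk

end
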